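import Summits.QuantumAdvantage.QuantumAdvantage.Theorems.LocusDialGroupPointerA
import Mathlib.Analysis.Fourier.FiniteAbelian.PontryaginDuality

/-!
# LocusDialGroupPointerB — group-hash pointers lose: `GroupHashPointerLoss3`, `ParityPointerLoss3` (part B of 2)

Cell decomp-qadv, seat lens-2, generation 17 — tree part «GroupPointer» (supports item stmt-QuantumAdvantage-27137; see part A).

§H APPLICATION: unit weight vectors `θ' : Fin N → ℂ` (`θA`, `hashProd_top`), the occupation phases `cA N a k` of part C with
zero bit phase (`phaseK_app0`), the bound `normSq_gAppSum_le` (`|Σ_{x odd} (∏_{x_i=1} θ'_i) χ(a(W_k+W))|² ≤ 4^{N-2j} 14^j`), the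
budget arithmetic `gpow_budget` (`256·4^s·7^j ≤ 8^j` for `j ≥ 12 s + 48`) and the usable form `norm_gAppSum_le`
(`16·m·‖Σ‖ ≤ 2^N` for `m ≤ 2^s`, `24 s + 98 ≤ N`); pointwise orthogonality on an arbitrary input set (`set_count_le`).
§I GROUP HASHES: `ghash g x = Σ_{x_i=1} g_i ∈ V`, fibres `gfib`, fibre sums `gfibSum`; characters are multiplicative along the
hash (`ψ_sum`, `ψ_ghash`) and unimodular (`ψ_normSq`, Mathlib `AddChar.norm_apply`); the fibre indicator `gfibre_indicator`
(`AddChar.sum_apply_eq_ite`), the expansion `gfibSum_expand`, the bound `gfibSum_bound` (`16·|V|·|gfibSum| ≤ 2^N`, summing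
`|AddChar V ℂ| = |V|` unit-weight sums, `AddChar.card_eq`), the fixed-size law `groupHashPointer_loss` (`≤ 3/4·2^{n-1}` for
`|V| ≤ 2^s`, `24 s + 98 ≤ n`) and **`groupHashPointerLoss3 : GroupHashPointerLoss3`** (`C = 1`; `s ≤ (log₂ n)^c ≤ √n`
eventually by the tree's `TubePlanProof.logPow_le_natSqrt`).
§J `parityHash S x : Fin s → ZMod 2` (subset parities) `= ghash` of indicator vectors (`parityHash_eq_ghash`) and
**`parityPointerLoss3 : ParityPointerLoss3`**.  §K `linHash M x = ghash (fun i s => M s i) x` and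
`affinePointerLoss3_of_groupHash : GroupHashPointerLoss3 → AffinePointerLoss3` (`|𝔽₃^t| = 3^t ≤ 2^{2t}`, `2t ≤ (log₂ n)^{c+1}`).

WHAT THIS IS NOT: pointers reading `𝔽₃`-QUADRATIC (or higher) forms of the bits are not product weights and stay open
(`FreePointerLoss3`, g18).  No `sorry`; standard axioms; no instances, no notation.
-/

set_option linter.dupNamespace false

noncomputable section

open scoped Classical

namespace Summit.QuantumAdvantage.QuantumAdvantage.Theorems.LocusDial

open Finset
open Literature.Computability.QuantumComplexity Literature.Computability.QuantumComplexity.RingHLF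
open Summit.QuantumAdvantage.AdviceFreeQNC0
open Summit.QuantumAdvantage.QuantumAdvantage.Theorems.HolonomyDial (gCond)

/-! ## §H  Application: unit bit weights + kernel occupation phases -/

section GApplication
variable {N : ℕ}

/-- extension of a weight vector on `Fin N` to `ℕ` (by `1`). -/
def θA (θ' : Fin N → ℂ) : ℕ → ℂ := fun i => if h : i < N then θ' ⟨i, h⟩ else 1

/-- LocusDialGroupPointerB helper `θA_normSq` (decomp-qadv land package; see the module docstring). -/
theorem θA_normSq (θ' : Fin N → ℂ) (hθ' : ∀ i, Complex.normSq (θ' i) = 1) (k : ℕ) :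
    Complex.normSq (θA θ' k) = 1 := by
  unfold θA
  split_ifs with h
  · exact hθ' _
  · simp

/-- LocusDialGroupPointerB helper `hashProd_top` (decomp-qadv land package; see the module docstring). -/
theorem hashProd_top (θ' : Fin N → ℂ) (x : Fin N → Bool) :
    hashProd (θA θ') N x = ∏ i : Fin N, if x i = true then θ' i else 1 := by
  unfold hashProd θA
  apply prod_congr rfl
  intro i _
  by_cases hx : x i = true
  · rw [if_pos ⟨i.isLt, hx⟩, if_pos hx, dif_pos i.isLt]
  · rw [if_neg (fun h => hx h.2), if_neg hx]

/-- LocusDialGroupPointerB helper `μA_zero` (decomp-qadv land package; see the module docstring). -/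
theorem μA_zero : μA (fun _ : Fin N => (0 : ZMod 3)) = fun _ => 0 := by
  funext i
  unfold μA
  split_ifs <;> rfl

/-- LocusDialGroupPointerB helper `phaseK_app0` (decomp-qadv land package; see the module docstring). -/
theorem phaseK_app0 (a : ZMod 3) (k : ℕ) (x : Fin N → Bool) :
    phaseK (fun _ => 0) (cA N a k) N x = a * (((Wk x k : ℕ) : ZMod 3) + ((Wk x (N - 1) : ℕ) : ZMod 3)) := by
  have h := phaseK_app (fun _ : Fin N => (0 : ZMod 3)) a k x
  rw [μA_zero] at h
  rw [h]
  simp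

/-- **application form**: for unit weights `θ'` and `a ≠ 0`,
`|Σ_{x odd} (∏_{x_i=1} θ'_i)·χ(a(W_k + W))|² ≤ 4^{N-2j} 14^j`. -/
theorem normSq_gAppSum_le (θ' : Fin N → ℂ) (hθ' : ∀ i, Complex.normSq (θ' i) = 1) {a : ZMod 3} (ha : a ≠ 0)
    (k : ℕ) :
    Complex.normSq (∑ x ∈ (univ : Finset (Fin N → Bool)).filter (fun x => OddZeros x),
      (∏ i : Fin N, if x i = true then θ' i else 1) *
        χ (a * (((Wk x k : ℕ) : ZMod 3) + ((Wk x (N - 1) : ℕ) : ZMod 3)))) ≤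
      4 ^ (N - 2 * ((N - 1) / 2)) * 14 ^ ((N - 1) / 2) := by
  have h := normSq_oddSumG_le (N := N) (θA θ') (cA N a k) (θA_normSq θ' hθ') (fun i hi => cA_ne_zero ha k i hi)
  have e : ∀ x : Fin N → Bool, hashProd (θA θ') N x * χ (phaseK (fun _ => 0) (cA N a k) N x) =
      (∏ i : Fin N, if x i = true then θ' i else 1) *
        χ (a * (((Wk x k : ℕ) : ZMod 3) + ((Wk x (N - 1) : ℕ) : ZMod 3))) := by
    intro x; rw [hashProd_top, phaseK_app0]
  simp_rw [e] at h
  exact h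

/-- the arithmetic of the budget: `256·4^s·7^j ≤ 8^j` once `j ≥ 12 s + 48`. -/
theorem gpow_budget (s j : ℕ) (h : 12 * s + 48 ≤ j) : 256 * 4 ^ s * 7 ^ j ≤ 8 ^ j := by
  obtain ⟨r, rfl⟩ : ∃ r, j = 12 * s + 48 + r := ⟨j - (12 * s + 48), by omega⟩
  have e7 : 7 ^ (12 * s + 48 + r) = (7 ^ 12) ^ s * 7 ^ 48 * 7 ^ r := by
    rw [pow_add, pow_add, pow_mul]
  have e8 : 8 ^ (12 * s + 48 + r) = (8 ^ 12) ^ s * 8 ^ 48 * 8 ^ r := by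
    rw [pow_add, pow_add, pow_mul]
  rw [e7, e8]
  have h1 : 4 ^ s * (7 ^ 12) ^ s ≤ (8 ^ 12) ^ s := by
    rw [← mul_pow]; exact Nat.pow_le_pow_left (by norm_num) s
  have h2 : 256 * 7 ^ 48 ≤ 8 ^ 48 := by norm_num
  have h3 : 7 ^ r ≤ 8 ^ r := Nat.pow_le_pow_left (by norm_num) r
  calc 256 * 4 ^ s * ((7 ^ 12) ^ s * 7 ^ 48 * 7 ^ r) = (4 ^ s * (7 ^ 12) ^ s) * (256 * 7 ^ 48) * 7 ^ r := by ring
    _ ≤ (8 ^ 12) ^ s * 8 ^ 48 * 8 ^ r := Nat.mul_le_mul (Nat.mul_le_mul h1 h2) h3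

/-- LocusDialGroupPointerB helper `gpow_budget'` (decomp-qadv land package; see the module docstring). -/
theorem gpow_budget' (s N : ℕ) (hN : 24 * s + 98 ≤ N) :
    (256 : ℝ) * 4 ^ s * (4 ^ (N - 2 * ((N - 1) / 2)) * 14 ^ ((N - 1) / 2)) ≤ 4 ^ N := by
  set j := (N - 1) / 2 with hj
  have h2j : 2 * j ≤ N := by omega
  have hjs : 12 * s + 48 ≤ j := by omega
  have hb := gpow_budget s j hjs
  have e14 : (14 : ℝ) ^ j = 7 ^ j * 2 ^ j := by rw [← mul_pow]; norm_num
  have e4 : (4 : ℝ) ^ N = 4 ^ (N - 2 * j) * (8 ^ j * 2 ^ j) := by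
    rw [← mul_pow, show ((8 : ℝ) * 2) = 4 ^ 2 by norm_num, ← pow_mul, ← pow_add]
    congr 1; omega
  rw [e14, e4]
  have hbR : (256 : ℝ) * 4 ^ s * 7 ^ j ≤ 8 ^ j := by exact_mod_cast hb
  have hp : (0 : ℝ) ≤ 4 ^ (N - 2 * j) * 2 ^ j := by positivity
  calc (256 : ℝ) * 4 ^ s * (4 ^ (N - 2 * j) * (7 ^ j * 2 ^ j))
      = (4 ^ (N - 2 * j) * 2 ^ j) * (256 * 4 ^ s * 7 ^ j) := by ring
    _ ≤ (4 ^ (N - 2 * j) * 2 ^ j) * 8 ^ j := mul_le_mul_of_nonneg_left hbR hp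
    _ = 4 ^ (N - 2 * j) * (8 ^ j * 2 ^ j) := by ring

/-- the usable form: `16·m·‖Σ‖ ≤ 2^N` for unit weights, `a ≠ 0`, `m ≤ 2^s`, `24 s + 98 ≤ N`. -/
theorem norm_gAppSum_le (θ' : Fin N → ℂ) (hθ' : ∀ i, Complex.normSq (θ' i) = 1) {a : ZMod 3} (ha : a ≠ 0)
    (k m s : ℕ) (hm : m ≤ 2 ^ s) (hN : 24 * s + 98 ≤ N) :
    (16 : ℝ) * m * ‖∑ x ∈ (univ : Finset (Fin N → Bool)).filter (fun x => OddZeros x),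
      (∏ i : Fin N, if x i = true then θ' i else 1) *
        χ (a * (((Wk x k : ℕ) : ZMod 3) + ((Wk x (N - 1) : ℕ) : ZMod 3)))‖ ≤ 2 ^ N := by
  set Z := ∑ x ∈ (univ : Finset (Fin N → Bool)).filter (fun x => OddZeros x),
      (∏ i : Fin N, if x i = true then θ' i else 1) *
        χ (a * (((Wk x k : ℕ) : ZMod 3) + ((Wk x (N - 1) : ℕ) : ZMod 3))) with hZ
  have h1 : Complex.normSq Z ≤ 4 ^ (N - 2 * ((N - 1) / 2)) * 14 ^ ((N - 1) / 2) := normSq_gAppSum_le θ' hθ' ha k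
  have h2 := gpow_budget' s N hN
  rw [Complex.normSq_eq_norm_sq] at h1
  have hmR : (m : ℝ) ≤ 2 ^ s := by exact_mod_cast hm
  have hm2 : (m : ℝ) ^ 2 ≤ 4 ^ s := by
    have : ((2 : ℝ) ^ s) ^ 2 = 4 ^ s := by rw [← pow_mul, mul_comm, pow_mul]; norm_num
    rw [← this]
    exact pow_le_pow_left₀ (by positivity) hmR 2
  have hsq : ((16 : ℝ) * m * ‖Z‖) ^ 2 ≤ (2 ^ N) ^ 2 := by
    have e : ((2 : ℝ) ^ N) ^ 2 = 4 ^ N := by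
      rw [← pow_mul, mul_comm, pow_mul]; norm_num
    rw [e]
    have h0 : (0 : ℝ) ≤ ‖Z‖ ^ 2 := by positivity
    have h0' : (0 : ℝ) ≤ 256 * 4 ^ s := by positivity
    calc ((16 : ℝ) * m * ‖Z‖) ^ 2 = 256 * (m : ℝ) ^ 2 * ‖Z‖ ^ 2 := by ring
      _ ≤ 256 * 4 ^ s * ‖Z‖ ^ 2 := by nlinarith [hm2]
      _ ≤ 256 * 4 ^ s * (4 ^ (N - 2 * ((N - 1) / 2)) * 14 ^ ((N - 1) / 2)) :=
          mul_le_mul_of_nonneg_left h1 h0'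
      _ ≤ 4 ^ N := h2
  have ha0 : (0 : ℝ) ≤ 16 * m * ‖Z‖ := by positivity
  have hb0 : (0 : ℝ) ≤ 2 ^ N := by positivity
  calc (16 : ℝ) * m * ‖Z‖ = Real.sqrt (((16 : ℝ) * m * ‖Z‖) ^ 2) := (Real.sqrt_sq ha0).symm
    _ ≤ Real.sqrt (((2 : ℝ) ^ N) ^ 2) := Real.sqrt_le_sqrt hsq
    _ = 2 ^ N := Real.sqrt_sq hb0

/-! ### pointwise orthogonality on an arbitrary set of inputs -/

/-- `#S ≤ 3·#{x ∈ S : φ_k(x) = 2} + |Σ_S χ(φ_k - 2)| + |Σ_S χ(2(φ_k - 2))|`. -/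
theorem set_count_le (S : Finset (Fin N → Bool)) (k : ℕ) :
    (S.card : ℝ) ≤ 3 * (S.filter (fun x => kph x k = 2)).card +
      ‖∑ x ∈ S, χ (1 * (kph x k - 2))‖ + ‖∑ x ∈ S, χ (2 * (kph x k - 2))‖ := by
  have h : (((3 * (S.filter (fun x => kph x k = 2)).card : ℕ)) : ℂ) =
      (S.card : ℂ) + ∑ x ∈ S, χ (1 * (kph x k - 2)) + ∑ x ∈ S, χ (2 * (kph x k - 2)) := by
    rw [card_eq_sum_ones S]
    push_cast
    rw [← sum_add_distrib, ← sum_add_distrib]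
    have hpt : ∀ x : Fin N → Bool, (1 : ℂ) + χ (1 * (kph x k - 2)) + χ (2 * (kph x k - 2)) =
        if kph x k = 2 then 3 else 0 := by
      intro x
      rw [one_mul, one_add_χ_add_χ (kph x k - 2)]
      simp only [sub_eq_zero]
    simp_rw [hpt]
    rw [sum_ite, sum_const_zero, add_zero, sum_const, nsmul_eq_mul, mul_comm]
  have e : (S.card : ℂ) = (((3 * (S.filter (fun x => kph x k = 2)).card : ℕ)) : ℂ) -
      ∑ x ∈ S, χ (1 * (kph x k - 2)) - ∑ x ∈ S, χ (2 * (kph x k - 2)) := by rw [h]; ring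
  have hn : ‖(S.card : ℂ)‖ ≤ ‖(((3 * (S.filter (fun x => kph x k = 2)).card : ℕ)) : ℂ)‖ +
      ‖∑ x ∈ S, χ (1 * (kph x k - 2))‖ + ‖∑ x ∈ S, χ (2 * (kph x k - 2))‖ := by
    rw [e]
    refine (norm_sub_le _ _).trans ?_
    have := norm_sub_le ((((3 * (S.filter (fun x => kph x k = 2)).card : ℕ)) : ℂ))
      (∑ x ∈ S, χ (1 * (kph x k - 2)))
    linarith
  rw [Complex.norm_natCast, Complex.norm_natCast] at hn
  push_cast at hn
  exact hn

end GApplication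

/-! ## §I  Group-valued hashes: fibres, character expansion over `AddChar V ℂ`, the theorem -/

section GroupHash
variable {N : ℕ} {V : Type} [AddCommGroup V] [Fintype V] [DecidableEq V]

/-- the GROUP HASH of the input: `h_g(x) = Σ_{i : x_i = 1} g_i ∈ V`. -/
def ghash (g : Fin N → V) (x : Fin N → Bool) : V := ∑ i : Fin N, if x i = true then g i else 0

/-- the odd-class fibre of the group hash over `v`. -/
def gfib (g : Fin N → V) (v : V) : Finset (Fin N → Bool) :=
  ((univ : Finset (Fin N → Bool)).filter (fun x => OddZeros x)).filter (fun x => ghash g x = v)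

/-- the character sum of the kernel phase over a group-hash fibre. -/
def gfibSum (g : Fin N → V) (v : V) (a : ZMod 3) (k : ℕ) : ℂ :=
  ∑ x ∈ gfib g v, χ (a * (kph x k - 2))

omit [Fintype V] [DecidableEq V] in
/-- LocusDialGroupPointerB helper `ψ_sum` (decomp-qadv land package; see the module docstring). -/
theorem ψ_sum {ι : Type} (ψ : AddChar V ℂ) (s : Finset ι) (f : ι → V) :
    ψ (∑ i ∈ s, f i) = ∏ i ∈ s, ψ (f i) := by
  induction s using Finset.induction_on with
  | empty => simp [AddChar.map_zero_eq_one]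
  | insert a s ha ih => rw [sum_insert ha, prod_insert ha, AddChar.map_add_eq_mul, ih]

omit [Fintype V] [DecidableEq V] in
/-- LocusDialGroupPointerB helper `ψ_ghash` (decomp-qadv land package; see the module docstring). -/
theorem ψ_ghash (ψ : AddChar V ℂ) (g : Fin N → V) (x : Fin N → Bool) :
    ψ (ghash g x) = ∏ i : Fin N, if x i = true then ψ (g i) else 1 := by
  unfold ghash
  rw [ψ_sum]
  apply prod_congr rfl
  intro i _
  split_ifs
  · rfl
  · exact AddChar.map_zero_eq_one ψ

omit [DecidableEq V] in
/-- LocusDialGroupPointerB helper `ψ_normSq` (decomp-qadv land package; see the module docstring). -/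
theorem ψ_normSq (ψ : AddChar V ℂ) (v : V) : Complex.normSq (ψ v) = 1 := by
  rw [Complex.normSq_eq_norm_sq, AddChar.norm_apply, one_pow]


end GroupHash
end Summit.QuantumAdvantage.QuantumAdvantage.Theorems.LocusDial
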